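import Summits.Ventures.CertifiedManyBodySolver.Theses.M3PrimeEdgeSplit

/-!
# Route `M3PrimeEdgeSplit` — ASSEMBLY item `Assembly` (stmt-Ventures-21722)

The assembly item of route `route-Ventures-M3PrimeEdgeSplit` is the implication
`UpperEdge_le_m3o4 → LowerEdge_ge_m4o5 → MbsolverRungLeaves.M3Window_tp0_M3prime`:
a certified upper row `hi ≤ -3/4` and a certified lower row `-4/5 ≤ lo` at `(U, n, t′) = (8, 7/8, 0)`
give the venture yardstick leaf `∃ lo hi, M3EnergyRow 0 lo hi ∧ M3Width lo hi`, the width bound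
`M3Width lo hi : hi - lo ≤ 1/20` being `hi - lo ≤ -3/4 + 4/5 = 1/20` (pure slot arithmetic, `linarith`).
Candidate proof attached to the item by refuter-parity-tllh-ref-1-g3-0 (Proof21722.lean); landed here by a prover.

HONEST FRAMING: bookkeeping glue only — it proves the IMPLICATION, not its hypotheses: both cruxes
(stmt-Ventures-21720 upper ≤ −3/4, stmt-Ventures-21721 lower ≥ −4/5) stay open in the tree; no number of
record moves; first certified bounds programme, not a superconductivity verdict; no summit statement is proved here.
-/

namespace Summit.Ventures.CertifiedManyBodySolver.Theorems

open Summit.Ventures.CertifiedManyBodySolver.Theses.M3PrimeEdgeSplit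

/-- The assembly item (stmt-Ventures-21722) of route `M3PrimeEdgeSplit`: an upper row at or below `-3/4` and a
lower row at or above `-4/5` at `(8, 7/8, 0)` (the latter by name the rung leaf
`MbsolverRungLeaves.M3Lower_tp0_ge_m4o5`) give the yardstick leaf `M3Window_tp0_M3prime`
(`∃ lo hi, M3EnergyRow 0 lo hi ∧ M3Width lo hi`), with `M3EnergyRow 0 lo hi = ⟨lower, upper⟩` and
`M3Width lo hi : hi - lo ≤ 1/20` from `hi - lo ≤ -3/4 - (-4/5) = 1/20`. -/
theorem m3PrimeEdgeSplitAssembly_proof :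
    Summit.Ventures.CertifiedManyBodySolver.Theses.M3PrimeEdgeSplit.Assembly := by
  intro hup hlow
  obtain ⟨hi, hhi, hU⟩ := hup
  obtain ⟨lo, hlo, hL⟩ := hlow
  refine ⟨lo, hi, ⟨hL, hU⟩, ?_⟩
  show hi - lo ≤ 1 / 20
  linarith

end Summit.Ventures.CertifiedManyBodySolver.Theorems
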